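import Literature.NumberTheory.CubicFields.CubicFieldDiscriminant4771
import HarnessLib

/-!
# The cubic field of discriminant `−4771` (LMFDB 3.1.4771.1), part 2: the primes above `p < 13` of norm `≤ 19` are principal — PROVED

Sequel of `CubicFieldDiscriminant4771.lean` (same seat, same namespace `Literature.NumberTheory.CubicFields.CubicDisc4771`; part 1: the polynomial,
`d_F = −4771`, `𝓞_F = ℤ[θ]`, signature).  THEOREMS ONLY; every statement PROVED.  §3: every prime of `𝓞_F` above `p ≤ 19` with `p^f ≤ 19` is
principal (explicit generators / inert primes, Dedekind–Kummer); §4: ★ `h_F = 1` by Minkowski (`(4/π)(3!/3³)√4771 ≈ 19.54 < 20`) and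
`not_two_dvd_classNumber`.  Written by the prover seat `bsd-line-att-p4` g28 with the lineage's g27 emitter (cell `bsd-f1-sign2`) for the odd-branch
seed of conductor `4771` of crux C2's cubic Chevalley road.

References: [LMFDB] number field 3.1.4771.1 (class number 1); [Marcus2018] Ch. 3 Thm. 27, Ch. 5 Thm. 37 and Cor. 2.
-/

noncomputable section

open Polynomial NumberField NumberField.InfinitePlace Ideal Module Real
open Literature.NumberTheory.NumberFields
open Literature.NumberTheory.NumberFields.MonicCubic

namespace Literature.NumberTheory.CubicFields.CubicDisc4771

section NumberField

variable {F : Type*} [Field F] [NumberField F] {α : F}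

/-! ## §3 The primes of norm `≤ 19` are principal -/

/-- The cubic relation `θ³ + aθ² + bθ + c = 0` in `𝓞_F`, numerals pushed (private helper). [folklore] -/
private theorem theta_rel (hα : aeval α (poly (-25) (-157) (-222)) = 0) :
    thetaInt hα ^ 3 + (-25) * thetaInt hα ^ 2 + (-157) * thetaInt hα + (-222) = 0 := by
  have h := thetaInt_rel hα
  push_cast at h
  linear_combination h

/-- `(2, θ + 0) = (-8 - 3 * θ)` (an element of norm `±2`). [cite: Marcus2018, Ch. 3, Thm. 27] -/
theorem span_2_lin0_eq (hα : aeval α (poly (-25) (-157) (-222)) = 0) :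
    span {(2 : 𝓞 F), thetaInt hα} = span {-8 - 3 * thetaInt hα} := by
  have hrel := theta_rel hα
  apply le_antisymm
  · rw [span_le]
    rintro x hx
    rcases hx with rfl | hx
    · exact mem_span_singleton'.mpr ⟨749 + 249 * thetaInt hα - 9 * thetaInt hα ^ 2, by linear_combination (27) * hrel⟩
    · rw [Set.mem_singleton_iff.mp hx]
      exact mem_span_singleton'.mpr ⟨-999 - 332 * thetaInt hα + 12 * thetaInt hα ^ 2, by linear_combination (-36) * hrel⟩
  · rw [span_singleton_le_iff_mem, mem_span_pair]
    exact ⟨551 + 394 * thetaInt hα + 65 * thetaInt hα ^ 2, -6 - 5 * thetaInt hα - 5 * thetaInt hα ^ 2, by linear_combination (-5) * hrel⟩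

/-- `(2, θ² + 1θ + 1) = (749 + 249 * θ - 9 * θ ^ 2)` (an element of norm `4`). [cite: Marcus2018, Ch. 3, Thm. 27] -/
theorem span_2_quad_eq (hα : aeval α (poly (-25) (-157) (-222)) = 0) :
    span {(2 : 𝓞 F), thetaInt hα ^ 2 + thetaInt hα + 1} = span {749 + 249 * thetaInt hα - 9 * thetaInt hα ^ 2} := by
  have hrel := theta_rel hα
  apply le_antisymm
  · rw [span_le]
    rintro x hx
    rcases hx with rfl | hx
    · exact mem_span_singleton'.mpr ⟨-8 - 3 * thetaInt hα, by linear_combination (27) * hrel⟩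
    · rw [Set.mem_singleton_iff.mp hx]
      exact mem_span_singleton'.mpr ⟨-337 - 241 * thetaInt hα - 43 * thetaInt hα ^ 2, by linear_combination (1137 + 387 * thetaInt hα) * hrel⟩
  · rw [span_singleton_le_iff_mem, mem_span_pair]
    exact ⟨18359 + 13513 * thetaInt hα + 2500 * thetaInt hα ^ 2, -5 - 6 * thetaInt hα - 6 * thetaInt hα ^ 2, by linear_combination (-162 - 6 * thetaInt hα) * hrel⟩

/-- **Every prime of `𝓞_F` above `2` is principal** (Dedekind–Kummer with `polyMod_2` and the generators above).
[cite: Marcus2018, Ch. 3, Thm. 27] [cite: LMFDB, number field 3.1.4771.1 (class number 1)] -/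
theorem isPrincipal_of_mem_primesOver_2 (h3 : finrank ℚ F = 3) (hα : aeval α (poly (-25) (-157) (-222)) = 0) {P : Ideal (𝓞 F)}
    (hP : P ∈ primesOver (span {((2 : ℕ) : ℤ)}) (𝓞 F)) : Submodule.IsPrincipal P := by
  haveI : Fact (Nat.Prime 2) := ⟨by norm_num⟩
  obtain ⟨Qb, hirr, hmon, hdvd, -, hspan⟩ :=
    exists_factor_of_mem_primesOver irreducible_polyQ hα h3 isUnit_of_disc_eq_sq_mul (by norm_num : Nat.Prime 2) hP
  rw [polyMod_2] at hdvd
  rcases hirr.prime.dvd_or_dvd hdvd with h | h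
  · have hQb : Qb = X := eq_of_monic_of_associated hmon monic_X (hirr.associated_of_dvd irreducible_X h)
    have hPeq := hspan X (by rw [hQb, Polynomial.map_X])
    rw [aeval_X, Nat.cast_ofNat, span_2_lin0_eq hα] at hPeq
    exact ⟨⟨-8 - 3 * thetaInt hα, by rw [hPeq, Ideal.submodule_span_eq]⟩⟩
  · have hQb : Qb = X ^ 2 + X + 1 :=
      eq_of_monic_of_associated hmon (by monicity!) (hirr.associated_of_dvd CubicDisc307.irreducible_quad_two h)
    have hPeq := hspan (X ^ 2 + X + 1) (by rw [hQb]; simp)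
    rw [show aeval (thetaInt hα) (X ^ 2 + X + 1 : ℤ[X]) = thetaInt hα ^ 2 + thetaInt hα + 1 by
        simp only [map_add, map_pow, aeval_X, map_one], Nat.cast_ofNat, span_2_quad_eq hα] at hPeq
    exact ⟨⟨749 + 249 * thetaInt hα - 9 * thetaInt hα ^ 2, by rw [hPeq, Ideal.submodule_span_eq]⟩⟩

/-- `(3, θ + 0) = (-3 - θ)` (an element of norm `±3`). [cite: Marcus2018, Ch. 3, Thm. 27] -/
theorem span_3_lin0_eq (hα : aeval α (poly (-25) (-157) (-222)) = 0) :
    span {(3 : 𝓞 F), thetaInt hα} = span {-3 - thetaInt hα} := by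
  have hrel := theta_rel hα
  apply le_antisymm
  · rw [span_le]
    rintro x hx
    rcases hx with rfl | hx
    · exact mem_span_singleton'.mpr ⟨73 + 28 * thetaInt hα - thetaInt hα ^ 2, by linear_combination (1) * hrel⟩
    · rw [Set.mem_singleton_iff.mp hx]
      exact mem_span_singleton'.mpr ⟨-74 - 28 * thetaInt hα + thetaInt hα ^ 2, by linear_combination (-1) * hrel⟩
  · rw [span_singleton_le_iff_mem, mem_span_pair]
    exact ⟨295 + 211 * thetaInt hα + 35 * thetaInt hα ^ 2, -6 - 5 * thetaInt hα - 4 * thetaInt hα ^ 2, by linear_combination (-4) * hrel⟩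

/-- `(3, θ² + 2θ + 2) = (73 + 28 * θ - θ ^ 2)` (an element of norm `9`). [cite: Marcus2018, Ch. 3, Thm. 27] -/
theorem span_3_quad_eq (hα : aeval α (poly (-25) (-157) (-222)) = 0) :
    span {(3 : 𝓞 F), thetaInt hα ^ 2 + 2 * thetaInt hα + 2} = span {73 + 28 * thetaInt hα - thetaInt hα ^ 2} := by
  have hrel := theta_rel hα
  apply le_antisymm
  · rw [span_le]
    rintro x hx
    rcases hx with rfl | hx
    · exact mem_span_singleton'.mpr ⟨-3 - thetaInt hα, by linear_combination (1) * hrel⟩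
    · rw [Set.mem_singleton_iff.mp hx]
      exact mem_span_singleton'.mpr ⟨-76 - 55 * thetaInt hα - 10 * thetaInt hα ^ 2, by linear_combination (25 + 10 * thetaInt hα) * hrel⟩
  · rw [span_singleton_le_iff_mem, mem_span_pair]
    exact ⟨12459 + 9252 * thetaInt hα + 1723 * thetaInt hα ^ 2, -4 - 6 * thetaInt hα - 6 * thetaInt hα ^ 2, by linear_combination (-168 - 6 * thetaInt hα) * hrel⟩

/-- **Every prime of `𝓞_F` above `3` is principal** (Dedekind–Kummer with `polyMod_3` and the generators above).
[cite: Marcus2018, Ch. 3, Thm. 27] [cite: LMFDB, number field 3.1.4771.1 (class number 1)] -/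
theorem isPrincipal_of_mem_primesOver_3 (h3 : finrank ℚ F = 3) (hα : aeval α (poly (-25) (-157) (-222)) = 0) {P : Ideal (𝓞 F)}
    (hP : P ∈ primesOver (span {((3 : ℕ) : ℤ)}) (𝓞 F)) : Submodule.IsPrincipal P := by
  haveI : Fact (Nat.Prime 3) := ⟨by norm_num⟩
  obtain ⟨Qb, hirr, hmon, hdvd, -, hspan⟩ :=
    exists_factor_of_mem_primesOver irreducible_polyQ hα h3 isUnit_of_disc_eq_sq_mul (by norm_num : Nat.Prime 3) hP
  rw [polyMod_3] at hdvd
  rcases hirr.prime.dvd_or_dvd hdvd with h | h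
  · have hQb : Qb = X := eq_of_monic_of_associated hmon monic_X (hirr.associated_of_dvd irreducible_X h)
    have hPeq := hspan X (by rw [hQb, Polynomial.map_X])
    rw [aeval_X, Nat.cast_ofNat, span_3_lin0_eq hα] at hPeq
    exact ⟨⟨-3 - thetaInt hα, by rw [hPeq, Ideal.submodule_span_eq]⟩⟩
  · have hQb : Qb = X ^ 2 + 2 * X + 2 :=
      eq_of_monic_of_associated hmon (by monicity!) (hirr.associated_of_dvd CubicDisc2515.irreducible_quad_3 h)
    have hPeq := hspan (X ^ 2 + C 2 * X + C 2) (by rw [hQb]; simp [map_ofNat])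
    rw [show aeval (thetaInt hα) (X ^ 2 + C 2 * X + C 2 : ℤ[X]) = thetaInt hα ^ 2 + 2 * thetaInt hα + 2 by
        simp only [map_add, map_mul, map_pow, aeval_X, aeval_C, algebraMap_int_eq, Int.coe_castRingHom, Int.cast_ofNat], Nat.cast_ofNat, span_3_quad_eq hα] at hPeq
    exact ⟨⟨73 + 28 * thetaInt hα - thetaInt hα ^ 2, by rw [hPeq, Ideal.submodule_span_eq]⟩⟩

/-- **Every prime of `𝓞_F` above `5` is principal**: `5` is inert, the prime is `(5)`. [cite: Marcus2018, Ch. 3, Thm. 27] -/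
theorem isPrincipal_of_mem_primesOver_5 (h3 : finrank ℚ F = 3) (hα : aeval α (poly (-25) (-157) (-222)) = 0) {P : Ideal (𝓞 F)}
    (hP : P ∈ primesOver (span {((5 : ℕ) : ℤ)}) (𝓞 F)) : Submodule.IsPrincipal P := by
  have hPeq := eq_span_of_no_root irreducible_polyQ hα h3 isUnit_of_disc_eq_sq_mul (by norm_num : Nat.Prime 5) hP no_root_5
  exact ⟨⟨((5 : ℕ) : 𝓞 F), by rw [hPeq, Ideal.submodule_span_eq]⟩⟩

/-- `(7, θ + 1) = (-11 - 4 * θ)` (an element of norm `±7`). [cite: Marcus2018, Ch. 3, Thm. 27] -/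
theorem span_7_lin1_eq (hα : aeval α (poly (-25) (-157) (-222)) = 0) :
    span {(7 : 𝓞 F), thetaInt hα + 1} = span {-11 - 4 * thetaInt hα} := by
  have hrel := theta_rel hα
  apply le_antisymm
  · rw [span_le]
    rintro x hx
    rcases hx with rfl | hx
    · exact mem_span_singleton'.mpr ⟨1291 + 444 * thetaInt hα - 16 * thetaInt hα ^ 2, by linear_combination (64) * hrel⟩
    · rw [Set.mem_singleton_iff.mp hx]
      exact mem_span_singleton'.mpr ⟨-323 - 111 * thetaInt hα + 4 * thetaInt hα ^ 2, by linear_combination (-16) * hrel⟩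
  · rw [span_singleton_le_iff_mem, mem_span_pair]
    exact ⟨31 + 23 * thetaInt hα + 4 * thetaInt hα ^ 2, -6 - 2 * thetaInt hα - thetaInt hα ^ 2, by linear_combination (-1) * hrel⟩

/-- **Every prime of `𝓞_F` above `7` with `7^f ≤ 19` is principal** (Dedekind–Kummer with `polyMod_7` and the generators above).
[cite: Marcus2018, Ch. 3, Thm. 27] [cite: LMFDB, number field 3.1.4771.1 (class number 1)] -/
theorem isPrincipal_of_mem_primesOver_7 (h3 : finrank ℚ F = 3) (hα : aeval α (poly (-25) (-157) (-222)) = 0) {P : Ideal (𝓞 F)}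
    (hP : P ∈ primesOver (span {((7 : ℕ) : ℤ)}) (𝓞 F))
    (hle : 7 ^ P.inertiaDeg ℤ ≤ 19) : Submodule.IsPrincipal P := by
  haveI : Fact (Nat.Prime 7) := ⟨by norm_num⟩
  obtain ⟨Qb, hirr, hmon, hdvd, hdeg, hspan⟩ :=
    exists_factor_of_mem_primesOver irreducible_polyQ hα h3 isUnit_of_disc_eq_sq_mul (by norm_num : Nat.Prime 7) hP
  rw [polyMod_7] at hdvd
  rcases hirr.prime.dvd_or_dvd hdvd with h | h
  · have hirr1 : Irreducible (X + 1 : (ZMod 7)[X]) := by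
      rw [show (X + 1 : (ZMod 7)[X]) = X - C (-1) by rw [map_neg, map_one, sub_neg_eq_add]]
      exact irreducible_X_sub_C _
    have hQb : Qb = X + 1 := eq_of_monic_of_associated hmon (by monicity!) (hirr.associated_of_dvd hirr1 h)
    have hPeq := hspan (X + 1) (by rw [hQb]; simp)
    rw [show aeval (thetaInt hα) (X + 1 : ℤ[X]) = thetaInt hα + 1 by
        simp only [map_add, aeval_X, map_one], Nat.cast_ofNat, span_7_lin1_eq hα] at hPeq
    exact ⟨⟨-11 - 4 * thetaInt hα, by rw [hPeq, Ideal.submodule_span_eq]⟩⟩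
  · have hQb : Qb = X ^ 2 + 2 * X + 2 :=
      eq_of_monic_of_associated hmon (by monicity!) (hirr.associated_of_dvd irreducible_quad_7 h)
    exfalso
    have hd2 : (X ^ 2 + 2 * X + 2 : (ZMod 7)[X]).natDegree = 2 := by compute_degree!
    rw [hdeg, hQb, hd2] at hle
    norm_num at hle

/-- `(11, θ + 8) = (-5 - 2 * θ)` (an element of norm `±11`). [cite: Marcus2018, Ch. 3, Thm. 27] -/
theorem span_11_lin8_eq (hα : aeval α (poly (-25) (-157) (-222)) = 0) :
    span {(11 : 𝓞 F), thetaInt hα + 8} = span {-5 - 2 * thetaInt hα} := by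
  have hrel := theta_rel hα
  apply le_antisymm
  · rw [span_le]
    rintro x hx
    rcases hx with rfl | hx
    · exact mem_span_singleton'.mpr ⟨353 + 110 * thetaInt hα - 4 * thetaInt hα ^ 2, by linear_combination (8) * hrel⟩
    · rw [Set.mem_singleton_iff.mp hx]
      exact mem_span_singleton'.mpr ⟨176 + 55 * thetaInt hα - 2 * thetaInt hα ^ 2, by linear_combination (4) * hrel⟩
  · rw [span_singleton_le_iff_mem, mem_span_pair]
    exact ⟨125 + 86 * thetaInt hα + 18 * thetaInt hα ^ 2, -6 - 6 * thetaInt hα ^ 2, by linear_combination (-6) * hrel⟩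

/-- `(11, θ + 6) = (83 + 28 * θ - θ ^ 2)` (an element of norm `±11`). [cite: Marcus2018, Ch. 3, Thm. 27] -/
theorem span_11_lin6_eq (hα : aeval α (poly (-25) (-157) (-222)) = 0) :
    span {(11 : 𝓞 F), thetaInt hα + 6} = span {83 + 28 * thetaInt hα - thetaInt hα ^ 2} := by
  have hrel := theta_rel hα
  apply le_antisymm
  · rw [span_le]
    rintro x hx
    rcases hx with rfl | hx
    · exact mem_span_singleton'.mpr ⟨-821 - 277 * thetaInt hα + 10 * thetaInt hα ^ 2, by linear_combination (307 - 10 * thetaInt hα) * hrel⟩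
    · rw [Set.mem_singleton_iff.mp hx]
      exact mem_span_singleton'.mpr ⟨-246 - 83 * thetaInt hα + 3 * thetaInt hα ^ 2, by linear_combination (92 - 3 * thetaInt hα) * hrel⟩
  · rw [span_singleton_le_iff_mem, mem_span_pair]
    exact ⟨31 + 19 * thetaInt hα + 3 * thetaInt hα ^ 2, -6 - 3 * thetaInt hα - thetaInt hα ^ 2, by linear_combination (-1) * hrel⟩

/-- `(11, θ + 5) = (-1967 - 665 * θ + 24 * θ ^ 2)` (an element of norm `±11`). [cite: Marcus2018, Ch. 3, Thm. 27] -/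
theorem span_11_lin5_eq (hα : aeval α (poly (-25) (-157) (-222)) = 0) :
    span {(11 : 𝓞 F), thetaInt hα + 5} = span {-1967 - 665 * thetaInt hα + 24 * thetaInt hα ^ 2} := by
  have hrel := theta_rel hα
  apply le_antisymm
  · rw [span_le]
    rintro x hx
    rcases hx with rfl | hx
    · exact mem_span_singleton'.mpr ⟨29 + 8 * thetaInt hα - thetaInt hα ^ 2, by linear_combination (257 - 24 * thetaInt hα) * hrel⟩
    · rw [Set.mem_singleton_iff.mp hx]
      exact mem_span_singleton'.mpr ⟨-7 - 8 * thetaInt hα - 2 * thetaInt hα ^ 2, by linear_combination (-62 - 48 * thetaInt hα) * hrel⟩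
  · rw [span_singleton_le_iff_mem, mem_span_pair]
    exact ⟨-55 + 28 * thetaInt hα + 19 * thetaInt hα ^ 2, -6 - 5 * thetaInt hα - 6 * thetaInt hα ^ 2, by linear_combination (-6) * hrel⟩

/-- **Every prime of `𝓞_F` above `11` is principal** (Dedekind–Kummer with `polyMod_11` and the generators above).
[cite: Marcus2018, Ch. 3, Thm. 27] [cite: LMFDB, number field 3.1.4771.1 (class number 1)] -/
theorem isPrincipal_of_mem_primesOver_11 (h3 : finrank ℚ F = 3) (hα : aeval α (poly (-25) (-157) (-222)) = 0) {P : Ideal (𝓞 F)}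
    (hP : P ∈ primesOver (span {((11 : ℕ) : ℤ)}) (𝓞 F)) : Submodule.IsPrincipal P := by
  haveI : Fact (Nat.Prime 11) := ⟨by norm_num⟩
  obtain ⟨Qb, hirr, hmon, hdvd, -, hspan⟩ :=
    exists_factor_of_mem_primesOver irreducible_polyQ hα h3 isUnit_of_disc_eq_sq_mul (by norm_num : Nat.Prime 11) hP
  rw [polyMod_11] at hdvd
  rcases hirr.prime.dvd_or_dvd hdvd with h12 | h
  · rcases hirr.prime.dvd_or_dvd h12 with h | h
    · have hirr1 : Irreducible (X + 8 : (ZMod 11)[X]) := by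
        rw [show (X + 8 : (ZMod 11)[X]) = X - C (-8) by rw [map_neg, map_ofNat]; ring]
        exact irreducible_X_sub_C _
      have hQb : Qb = X + 8 := eq_of_monic_of_associated hmon (by monicity!) (hirr.associated_of_dvd hirr1 h)
      have hPeq := hspan (X + C 8) (by rw [hQb]; simp [map_ofNat])
      rw [show aeval (thetaInt hα) (X + C 8 : ℤ[X]) = thetaInt hα + 8 by
          simp only [map_add, aeval_X, aeval_C, algebraMap_int_eq, Int.coe_castRingHom, Int.cast_ofNat], Nat.cast_ofNat, span_11_lin8_eq hα] at hPeq
      exact ⟨⟨-5 - 2 * thetaInt hα, by rw [hPeq, Ideal.submodule_span_eq]⟩⟩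
    · have hirr1 : Irreducible (X + 6 : (ZMod 11)[X]) := by
        rw [show (X + 6 : (ZMod 11)[X]) = X - C (-6) by rw [map_neg, map_ofNat]; ring]
        exact irreducible_X_sub_C _
      have hQb : Qb = X + 6 := eq_of_monic_of_associated hmon (by monicity!) (hirr.associated_of_dvd hirr1 h)
      have hPeq := hspan (X + C 6) (by rw [hQb]; simp [map_ofNat])
      rw [show aeval (thetaInt hα) (X + C 6 : ℤ[X]) = thetaInt hα + 6 by
          simp only [map_add, aeval_X, aeval_C, algebraMap_int_eq, Int.coe_castRingHom, Int.cast_ofNat], Nat.cast_ofNat, span_11_lin6_eq hα] at hPeq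
      exact ⟨⟨83 + 28 * thetaInt hα - thetaInt hα ^ 2, by rw [hPeq, Ideal.submodule_span_eq]⟩⟩
  · have hirr1 : Irreducible (X + 5 : (ZMod 11)[X]) := by
      rw [show (X + 5 : (ZMod 11)[X]) = X - C (-5) by rw [map_neg, map_ofNat]; ring]
      exact irreducible_X_sub_C _
    have hQb : Qb = X + 5 := eq_of_monic_of_associated hmon (by monicity!) (hirr.associated_of_dvd hirr1 h)
    have hPeq := hspan (X + C 5) (by rw [hQb]; simp [map_ofNat])
    rw [show aeval (thetaInt hα) (X + C 5 : ℤ[X]) = thetaInt hα + 5 by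
        simp only [map_add, aeval_X, aeval_C, algebraMap_int_eq, Int.coe_castRingHom, Int.cast_ofNat], Nat.cast_ofNat, span_11_lin5_eq hα] at hPeq
    exact ⟨⟨-1967 - 665 * thetaInt hα + 24 * thetaInt hα ^ 2, by rw [hPeq, Ideal.submodule_span_eq]⟩⟩

end NumberField

end Literature.NumberTheory.CubicFields.CubicDisc4771

end
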